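import Literature.Probability.LatticeModels.GridDomainHittingProbabilityProofs
import Literature.Probability.LatticeModels.GridDomainBoundaryHittingProofs
import Literature.Probability.LatticeModels.KilledGreenMonotone
import Literature.Probability.LatticeModels.KilledWalkGreen
import Literature.Probability.LatticeModels.WeakBeurlingEstimate
import Mathlib.Analysis.Normed.Group.Tannery
import HarnessLib

/-!
# The killed Green function of an unbounded grid domain through finite windows: truncation,
# the bound `G(x,q) ≤ G(q,q)`, superlevel connectivity, and two comparison principles

Topic `Literature/Probability/LatticeModels` (discrete potential theory on `ℤ²`; continuation of
`GridDomainHittingProbabilityProofs.lean`, towards G. F. Lawler, O. Schramm, W. Werner, *Conformal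
invariance of planar loop-erased random walks and uniform spanning trees*, Ann. Probab. 32 (2004),
Prop. 2.2, whose proof (§5.2) manipulates the discrete harmonic function `h = H(·,u)/H(0,u)`,
i.e. `G(·,q)/G(0,q)` with `G` the Green function of the walk on `V(D)` killed at its first step
out of `V(D)`, through the maximum principle: "the maximum principle shows that `K'` is connected
and contains a simple nearest neighbor path `J` joining `W` to `u`"; "since `h` is positive,
harmonic, `h(0) = 1` and `h ≥ M/2` on `J`, this also gives the bound `M ≤ c(ε)`"; "`W` separates
`V(δ, ε₁)` from `u` … then `h(z) ≤ M ε₂`").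

The grid domains of the class `𝔇` may be unbounded, so `V(D)` may be infinite and the maximum
principle of `KilledWalkLaplacian.lean` (finite sets) does not apply directly; the Green function,
however, is a sum over FINITE walks, and is therefore the increasing limit of the Green functions
of the walk restricted to finite windows, to which it does. This file proves:

* `SRW.transitEvent_siteGraph_inter_eq`, `SRW.killedTrans_siteGraph_inter_eq`,
  `SRW.tendsto_killedGreen_sqBox` — **truncation**: an `n`-step transit of the walk on `V` from `p`
  stays in the box `sqBox p n`, so it is a transit of the walk on `V ∩ W` for every window
  `W ⊇ sqBox p n`; hence `G_{V ∩ sqBox c N}(p, q) → G_V(p, q)` as `N → ∞` (dominated convergence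
  for the series over `n`), and `G_{V'} ≤ G_V` for `V' ⊆ V` (`SRW.killedGreen_mono_of_summable`).
* `SRW.killedGreen_le_killedGreen_self` — **`G(x, q) ≤ G(q, q)`** (maximum principle on the finite
  windows, then the limit).
* `SRW.reachable_superlevel` — **superlevel sets of `G(·, q)` are connected to the pole**: for
  `G(z₀, q) > 0` and `0 ≤ θ < 1` the pole `q` is reachable from `z₀` through lattice points `u` of
  `V` with `G(u, q) ≥ θ G(z₀, q)` (the "maximum principle shows that `K'` is connected" step).
* `LSWGrid.killedGreen_le_mul_hitBeforeExitProb` — **upper comparison**: if `B` misses the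
  pole and `G(·, q) ≤ M` at the points of `V(D) ∖ B` adjacent to `B`, then on `B`,
  `G(x, q) ≤ M · P_x[the walk reaches V(D) ∖ B before being killed]` (the "`h(z) ≤ M ε₂`" step).
* `LSWGrid.mul_one_sub_hitBeforeExitProb_le_killedGreen` — **lower comparison**: if `U ⊆ V(D)` is
  finite, no site of `U` is adjacent to a point outside `V(D)`, every lattice
  neighbour of `U` outside `U` lies in `J ∪ Far`, and `G(·, q) ≥ m` on `J`, then on `U`,
  `G(x, q) ≥ m · (1 - P_x[the walk reaches Far before being killed])` (the "`h ≥ M/2` on `J`" step,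
  in the form needed when `J` screens the boundary).

Everything is proved ([folklore] potential theory of the killed walk, Lawler–Limic 2010 §6.1–6.2);
no definition and no named fact is introduced.

## References

* G. F. Lawler, O. Schramm, W. Werner, Ann. Probab. 32 (2004) 939–995, §5.2 [LawlerSchrammWerner2004].
* G. F. Lawler, V. Limic, *Random Walk: A Modern Introduction*, CUP (2010), §4.6, §6.1–6.2
  [LawlerLimic2010].
-/

noncomputable section

open Set Metric Filter
open scoped Topology Classical

namespace Literature.Probability.LatticeModels

open Literature.Probability.RandomPlanarGeometry (ChordalLERW.siteGraph ChordalLERW.siteGraph_adj_iff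
  ChordalLERW.siteGraph_le_zdGraph)
open WeakBeurling (sqBox mem_sqBox sqBox_mono sqBox_finite mem_sqBox_succ_of_adj)

/-! ### The site graphs: monotonicity, support -/

/-- `siteGraph` is monotone in the vertex set. [folklore] -/
theorem siteGraph_mono {A B : Set (Site 2)} (h : A ⊆ B) :
    ChordalLERW.siteGraph A ≤ ChordalLERW.siteGraph B := by
  intro x y hxy
  rw [ChordalLERW.siteGraph_adj_iff] at hxy ⊢
  exact ⟨hxy.1, h hxy.2.1, h hxy.2.2⟩

/-- The non-isolated vertices of `siteGraph A` lie in `A`. [folklore] -/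
theorem support_siteGraph_subset (A : Set (Site 2)) : (ChordalLERW.siteGraph A).support ⊆ A := by
  intro x hx
  obtain ⟨y, hy⟩ := (SimpleGraph.mem_support _).1 hx
  exact (ChordalLERW.siteGraph_adj_iff.1 hy).2.1

/-- A finite vertex set gives a site graph with finite support. [folklore] -/
theorem finite_support_siteGraph {A : Set (Site 2)} (hA : A.Finite) :
    (ChordalLERW.siteGraph A).support.Finite :=
  hA.subset (support_siteGraph_subset A)

/-- Boxes about different centres: `sqBox p k ⊆ sqBox c N` once `N` exceeds `k` by the
coordinate distances of the centres. [folklore] -/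
theorem sqBox_subset_sqBox {p c : Site 2} {k N : ℤ} (h0 : k + |p 0 - c 0| ≤ N)
    (h1 : k + |p 1 - c 1| ≤ N) : sqBox p k ⊆ sqBox c N := by
  intro z hz
  rw [mem_sqBox] at hz ⊢
  constructor
  · calc |z 0 - c 0| = |(z 0 - p 0) + (p 0 - c 0)| := by ring_nf
      _ ≤ |z 0 - p 0| + |p 0 - c 0| := abs_add_le _ _
      _ ≤ N := by linarith [hz.1]
  · calc |z 1 - c 1| = |(z 1 - p 1) + (p 1 - c 1)| := by ring_nf
      _ ≤ |z 1 - p 1| + |p 1 - c 1| := abs_add_le _ _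
      _ ≤ N := by linarith [hz.2]

/-- The centre lies in its boxes of nonnegative radius. [folklore] -/
theorem self_mem_sqBox (p : Site 2) {n : ℤ} (hn : 0 ≤ n) : p ∈ sqBox p n := by
  rw [mem_sqBox]; simp [hn]

namespace SRW

/-! ### Truncation of the killed Green function to finite windows -/

/-- `transitEvent` is monotone in the graph. [folklore] -/
theorem transitEvent_mono {d : ℕ} {Gr Gr' : SimpleGraph (Site d)} (h : Gr ≤ Gr') (n : ℕ) (p q : Site d) :
    transitEvent Gr n p q ⊆ transitEvent Gr' n p q :=
  fun _ hω => ⟨fun j hj => h (hω.1 j hj), hω.2⟩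

/-- **`G` is monotone in the graph** when the larger series converges (the tree's
`SRW.killedGreen_mono` assumes finite support instead). [folklore] -/
theorem killedGreen_mono_of_summable {d : ℕ} [NeZero d] {Gr Gr' : SimpleGraph (Site d)} (h : Gr ≤ Gr') {p q : Site d}
    (hsum : Summable fun n => killedTrans Gr' n p q) : killedGreen Gr p q ≤ killedGreen Gr' p q :=
  (hsum.of_nonneg_of_le (fun n => killedTrans_nonneg Gr n p q) fun n => killedTrans_mono h n p q).tsum_le_tsum
    (fun n => killedTrans_mono h n p q) hsum

/-- **An `n`-step transit along lattice edges stays in the box of radius `n`**: on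
`transitEvent (siteGraph V) n p q` the position at every time `j ≤ n` lies in `sqBox p j`. [folklore] -/
theorem mem_sqBox_of_transitEvent {V : Set (Site 2)} {n : ℕ} {p q : Site 2} {ω : PathSpace 2}
    (hω : ω ∈ transitEvent (ChordalLERW.siteGraph V) n p q) {j : ℕ} (hj : j ≤ n) :
    p + S ω j ∈ sqBox p j := by
  induction j with
  | zero =>
      rw [S_zero, add_zero]
      exact self_mem_sqBox p le_rfl
  | succ j ih =>
      have hadj := hω.1 j (Nat.lt_of_succ_le hj)
      have hlat : (zdGraph 2).Adj (p + S ω j) (p + S ω (j + 1)) := ChordalLERW.siteGraph_le_zdGraph _ hadj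
      have h := mem_sqBox_succ_of_adj (ih (Nat.le_of_succ_le hj)) hlat
      push_cast
      exact h

/-- **Transits of the walk on `V` are transits of the walk on `V ∩ W` for every window `W`
containing the box of radius `n` about the start.** [folklore] -/
theorem transitEvent_siteGraph_inter_eq {V W : Set (Site 2)} {n : ℕ} {p : Site 2}
    (hW : sqBox p n ⊆ W) (q : Site 2) :
    transitEvent (ChordalLERW.siteGraph (V ∩ W)) n p q = transitEvent (ChordalLERW.siteGraph V) n p q := by
  refine Subset.antisymm (transitEvent_mono (siteGraph_mono inter_subset_left) n p q) fun ω hω => ?_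
  refine ⟨fun j hj => ?_, hω.2⟩
  have hadj := hω.1 j hj
  rw [ChordalLERW.siteGraph_adj_iff] at hadj ⊢
  have h1 : p + S ω j ∈ W :=
    hW (sqBox_mono p (by exact_mod_cast hj.le) (mem_sqBox_of_transitEvent hω hj.le))
  have h2 : p + S ω (j + 1) ∈ W :=
    hW (sqBox_mono p (by exact_mod_cast Nat.succ_le_of_lt hj)
      (mem_sqBox_of_transitEvent hω (Nat.succ_le_of_lt hj)))
  exact ⟨hadj.1, ⟨hadj.2.1, h1⟩, ⟨hadj.2.2, h2⟩⟩

/-- The `n`-step killed transition probabilities of the walk on `V` and on `V ∩ W` agree for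
windows `W ⊇ sqBox p n`. [folklore] -/
theorem killedTrans_siteGraph_inter_eq {V W : Set (Site 2)} {n : ℕ} {p : Site 2}
    (hW : sqBox p n ⊆ W) (q : Site 2) :
    killedTrans (ChordalLERW.siteGraph (V ∩ W)) n p q = killedTrans (ChordalLERW.siteGraph V) n p q := by
  rw [killedTrans_eq, killedTrans_eq, transitEvent_siteGraph_inter_eq hW q]

/-- **The Green function of the walk on `V` is the limit of the Green functions of the walk on the
finite windows `V ∩ sqBox c N`** (dominated convergence for the series over the number of steps:
the `n`-th terms agree once `sqBox p n ⊆ sqBox c N`, and are dominated by those of `V`). [folklore] -/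
theorem tendsto_killedGreen_sqBox {V : Set (Site 2)} {p q : Site 2} (c : Site 2)
    (hsum : Summable fun n => killedTrans (ChordalLERW.siteGraph V) n p q) :
    Tendsto (fun N : ℕ => killedGreen (ChordalLERW.siteGraph (V ∩ sqBox c N)) p q) atTop
      (𝓝 (killedGreen (ChordalLERW.siteGraph V) p q)) := by
  unfold killedGreen
  refine tendsto_tsum_of_dominated_convergence hsum (fun k => ?_) (Eventually.of_forall fun N k => ?_)
  · -- eventually the `k`-th terms agree
    set m : ℕ := k + (|p 0 - c 0|).toNat + (|p 1 - c 1|).toNat with hm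
    refine (tendsto_const_nhds (x := killedTrans (ChordalLERW.siteGraph V) k p q)).congr' ?_
    filter_upwards [eventually_ge_atTop m] with N hN
    refine (killedTrans_siteGraph_inter_eq (sqBox_subset_sqBox ?_ ?_) q).symm
    · have h0 : (|p 0 - c 0| : ℤ) ≤ ((|p 0 - c 0|).toNat : ℤ) := Int.self_le_toNat _
      have : ((m : ℕ) : ℤ) ≤ N := by exact_mod_cast hN
      push_cast [hm] at this
      linarith
    · have h1 : (|p 1 - c 1| : ℤ) ≤ ((|p 1 - c 1|).toNat : ℤ) := Int.self_le_toNat _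
      have : ((m : ℕ) : ℤ) ≤ N := by exact_mod_cast hN
      push_cast [hm] at this
      linarith
  · rw [Real.norm_of_nonneg (killedTrans_nonneg _ _ _ _)]
    exact killedTrans_mono (siteGraph_mono inter_subset_left) k p q

/-! ### `G(x, q) ≤ G(q, q)` -/

/-- On a FINITE vertex set: `G(x, q) ≤ G(q, q)` for the walk on `S` (maximum principle on
`S ∖ {q}` for the killed-harmonic `G(·, q)`, whose only exit site for the walk is `q`). [folklore] -/
theorem killedGreen_le_killedGreen_self_of_finite {S : Set (Site 2)} (hS : S.Finite) (x q : Site 2) :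
    killedGreen (ChordalLERW.siteGraph S) x q ≤ killedGreen (ChordalLERW.siteGraph S) q q := by
  set Gr := ChordalLERW.siteGraph S with hGr
  have hsum : ∀ y, Summable fun n => killedTrans Gr n y q := fun y =>
    summable_killedTrans_of_finite_support (finite_support_siteGraph hS) y q
  by_cases hxq : x = q
  · rw [hxq]
  by_cases hxS : x ∈ S
  · have hT : (S \ {q}).Finite := hS.sdiff
    have hharm : IsKilledHarmonicOn Gr (fun p => killedGreen Gr p q) (S \ {q}) :=
      (isKilledHarmonicOn_killedGreen hsum).mono fun p hp => hp.2
    refine hharm.le_of_forall_boundary_le hT (killedGreen_nonneg _ _ _) ?_ x ⟨hxS, hxq⟩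
    rintro w ⟨hwT, v, -, e, rfl, hadj⟩
    have hwS : v + stepVec e ∈ S := (ChordalLERW.siteGraph_adj_iff.1 hadj).2.2
    have hwq : v + stepVec e = q := by
      by_contra h
      exact hwT ⟨hwS, h⟩
    rw [hwq]
  · rw [killedGreen_eq_zero_of_forall_not_adj (fun y hy => hxS (ChordalLERW.siteGraph_adj_iff.1 hy).2.1) hxq]
    exact killedGreen_nonneg _ _ _

/-- **`G(x, q) ≤ G(q, q)`** for the walk on an arbitrary vertex set `V ⊆ ℤ²`, whenever the series
at `x` and at `q` converge (limit of the finite-window inequality). [folklore] -/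
theorem killedGreen_le_killedGreen_self {V : Set (Site 2)} {x q : Site 2}
    (hx : Summable fun n => killedTrans (ChordalLERW.siteGraph V) n x q)
    (hq : Summable fun n => killedTrans (ChordalLERW.siteGraph V) n q q) :
    killedGreen (ChordalLERW.siteGraph V) x q ≤ killedGreen (ChordalLERW.siteGraph V) q q :=
  le_of_tendsto_of_tendsto' (tendsto_killedGreen_sqBox 0 hx) (tendsto_killedGreen_sqBox 0 hq) fun N =>
    killedGreen_le_killedGreen_self_of_finite ((sqBox_finite 0 N).inter_of_right V) x q

/-- `G(x, q) > 0` forces `x ∈ V` or `x = q`. [folklore] -/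
theorem mem_of_killedGreen_pos {V : Set (Site 2)} {x q : Site 2}
    (h : 0 < killedGreen (ChordalLERW.siteGraph V) x q) (hxq : x ≠ q) : x ∈ V := by
  by_contra hx
  have := killedGreen_eq_zero_of_forall_not_adj (Gr := ChordalLERW.siteGraph V)
    (fun y hy => hx (ChordalLERW.siteGraph_adj_iff.1 hy).2.1) hxq
  linarith

/-! ### Superlevel sets of `G(·, q)` reach the pole -/

/-- **Superlevel connectivity** (the step "the maximum principle shows that `K'` is connected and
contains a simple nearest neighbor path `J` joining `W` to `u`" of the proof of LSW's Prop. 2.2):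
if `G(z₀, q) > 0` and `0 ≤ θ < 1`, then `q` is reachable from `z₀` in the site graph of
`K = {u ∈ V : G(u, q) ≥ θ G(z₀, q)}`, i.e. through lattice points of `V` where `G(·, q)` is at
least `θ G(z₀, q)`. Proof: otherwise, on a large finite window the component of `z₀` in the
corresponding superlevel set of the WINDOWED Green function (which increases to `G`) misses `q`, is
finite, and has windowed Green function `< θ G(z₀,q)` on its exit sites — contradicting the maximum
principle at `z₀`, where the windowed Green function exceeds `θ G(z₀,q)`.
[cite: LawlerSchrammWerner2004, §5.2] -/
theorem reachable_superlevel {V : Set (Site 2)} {z₀ q : Site 2}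
    (hsum : ∀ y, Summable fun n => killedTrans (ChordalLERW.siteGraph V) n y q)
    (hz₀ : 0 < killedGreen (ChordalLERW.siteGraph V) z₀ q) {θ : ℝ} (hθ0 : 0 ≤ θ) (hθ : θ < 1) :
    (ChordalLERW.siteGraph {u | u ∈ V ∧
      θ * killedGreen (ChordalLERW.siteGraph V) z₀ q ≤ killedGreen (ChordalLERW.siteGraph V) u q}).Reachable
      z₀ q := by
  by_contra hnr
  by_cases hzq : z₀ = q
  · exact hnr (hzq ▸ SimpleGraph.Reachable.refl _)
  have hz₀V : z₀ ∈ V := mem_of_killedGreen_pos hz₀ hzq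
  set G : Site 2 → ℝ := fun u => killedGreen (ChordalLERW.siteGraph V) u q with hG
  set c₀ : ℝ := θ * G z₀ with hc₀
  have hc₀0 : 0 ≤ c₀ := mul_nonneg hθ0 hz₀.le
  have hc₀lt : c₀ < G z₀ := by
    have : θ * G z₀ < 1 * G z₀ := mul_lt_mul_of_pos_right hθ hz₀
    rwa [one_mul] at this
  -- a window on which the windowed Green function at `z₀` already exceeds `c₀`
  have hT := tendsto_killedGreen_sqBox z₀ (hsum z₀)
  obtain ⟨N, hN⟩ := (eventually_atTop.1 (hT.eventually (lt_mem_nhds hc₀lt)))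
  have hNz : c₀ < killedGreen (ChordalLERW.siteGraph (V ∩ sqBox z₀ N)) z₀ q := hN N le_rfl
  set VN : Set (Site 2) := V ∩ sqBox z₀ N with hVN
  set GrN := ChordalLERW.siteGraph VN with hGrN
  set GN : Site 2 → ℝ := fun u => killedGreen GrN u q with hGN
  have hVNfin : VN.Finite := (sqBox_finite z₀ N).inter_of_right V
  have hsumN : ∀ y, Summable fun n => killedTrans GrN n y q := fun y =>
    summable_killedTrans_of_finite_support (finite_support_siteGraph hVNfin) y q
  have hGNle : ∀ u, GN u ≤ G u := fun u => killedGreen_mono_of_summable (siteGraph_mono inter_subset_left) (hsum u)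
  -- the windowed superlevel set and the component of `z₀`
  set KN : Set (Site 2) := {u | u ∈ VN ∧ c₀ ≤ GN u} with hKN
  set C : Set (Site 2) := {u | (ChordalLERW.siteGraph KN).Reachable z₀ u} with hC
  have hz₀KN : z₀ ∈ KN := ⟨⟨hz₀V, self_mem_sqBox z₀ (by positivity)⟩, hNz.le⟩
  have hCKN : C ⊆ KN := by
    intro u hu
    by_cases huz : z₀ = u
    · exact huz ▸ hz₀KN
    · exact support_siteGraph_subset KN
        (SimpleGraph.mem_support_of_reachable (fun h => huz h.symm) (SimpleGraph.Reachable.symm hu))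
  have hKsub : KN ⊆ {u | u ∈ V ∧ θ * killedGreen (ChordalLERW.siteGraph V) z₀ q ≤
      killedGreen (ChordalLERW.siteGraph V) u q} :=
    fun u hu => ⟨hu.1.1, hu.2.trans (hGNle u)⟩
  have hqC : q ∉ C := fun hq => hnr (hq.mono (siteGraph_mono hKsub))
  have hCfin : C.Finite := hVNfin.subset (hCKN.trans fun u hu => hu.1)
  -- `GN` is killed-harmonic on `C` for the walk on the window
  have hharm : IsKilledHarmonicOn GrN GN C :=
    (isKilledHarmonicOn_killedGreen hsumN).mono fun u hu huq => hqC (huq ▸ hu)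
  -- its exit sites have `GN < c₀`
  have hbdry : ∀ w ∈ killedOuterBoundary GrN C, GN w ≤ c₀ := by
    rintro w ⟨hwC, v, hv, e, rfl, hadj⟩
    have hwVN : v + stepVec e ∈ VN := (ChordalLERW.siteGraph_adj_iff.1 hadj).2.2
    by_contra hlt
    push Not at hlt
    have hwKN : v + stepVec e ∈ KN := ⟨hwVN, hlt.le⟩
    have hadjK : (ChordalLERW.siteGraph KN).Adj v (v + stepVec e) :=
      ChordalLERW.siteGraph_adj_iff.2 ⟨(ChordalLERW.siteGraph_adj_iff.1 hadj).1, hCKN hv, hwKN⟩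
    exact hwC (SimpleGraph.Reachable.trans hv hadjK.reachable)
  have hle := hharm.le_of_forall_boundary_le hCfin hc₀0 hbdry z₀ (SimpleGraph.Reachable.refl _)
  exact absurd hle (not_le.2 hNz)

end SRW

/-! ### Two comparison principles for `G(·, q)` on a grid domain -/

namespace LSWGrid

/-- **Upper comparison principle** (the step "`h(z) ≤ M ε₂` for all `z ∈ V(δ, ε₁)`" of the proof of
LSW's Prop. 2.2): let `B` miss the pole `q`, and suppose `G(y, q) ≤ M` (`M ≥ 0`) at every
`y ∈ V(D) ∖ B` adjacent to a point of `B`. Then for `x ∈ B`,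
`G(x, q) ≤ M · hitBeforeExitProb D x (V(D) ∖ B)`: the walk from `x` must reach `V(D) ∖ B` alive
to see the pole, and does so at a site where `G ≤ M`. Proof on finite windows (maximum principle
for the windowed Green function against `M` times the probability of leaving `B ∩ window` alive,
which is at most the hitting probability by the super-mean-value comparison), then the limit.
[cite: LawlerSchrammWerner2004, §5.2] -/
theorem killedGreen_le_mul_hitBeforeExitProb {D : Set ℂ} {q : Site 2}
    (hsum : ∀ y, Summable fun n =>
      SRW.killedTrans (ChordalLERW.siteGraph (latticeVertices D)) n y q)
    {B : Set (Site 2)} (hqB : q ∉ B) {M : ℝ} (hM0 : 0 ≤ M)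
    (hM : ∀ y ∈ latticeVertices D, y ∉ B → (∃ b ∈ B, (zdGraph 2).Adj b y) →
      SRW.killedGreen (ChordalLERW.siteGraph (latticeVertices D)) y q ≤ M)
    {x : Site 2} (hx : x ∈ B) :
    SRW.killedGreen (ChordalLERW.siteGraph (latticeVertices D)) x q ≤
      M * hitBeforeExitProb D x (latticeVertices D \ B) := by
  set V := latticeVertices D with hV
  set hit : Site 2 → ℝ := fun y => hitBeforeExitProb D y (V \ B) with hhit
  refine le_of_tendsto' (SRW.tendsto_killedGreen_sqBox x (hsum x)) fun N => ?_
  -- the window, the finite piece of `B`, the windowed walk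
  set VN : Set (Site 2) := V ∩ sqBox x N with hVN
  set GrN := ChordalLERW.siteGraph VN with hGrN
  set GN : Site 2 → ℝ := fun u => SRW.killedGreen GrN u q with hGN
  set S : Set (Site 2) := B ∩ sqBox x N with hS
  have hSfin : S.Finite := (sqBox_finite x N).inter_of_right B
  have hVNfin : VN.Finite := (sqBox_finite x N).inter_of_right V
  have hxS : x ∈ S := ⟨hx, self_mem_sqBox x (by positivity)⟩
  have hsumN : ∀ y, Summable fun n => SRW.killedTrans GrN n y q := fun y =>
    SRW.summable_killedTrans_of_finite_support (finite_support_siteGraph hVNfin) y q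
  have hGNle : ∀ u, GN u ≤ SRW.killedGreen (ChordalLERW.siteGraph V) u q := fun u =>
    SRW.killedGreen_mono_of_summable (siteGraph_mono inter_subset_left) (hsum u)
  have hGrNle : GrN ≤ ChordalLERW.siteGraph V := siteGraph_mono inter_subset_left
  -- exit sites of `S` for the windowed walk lie in `V ∖ B`, adjacent to `B`
  have hexit : ∀ w ∈ killedOuterBoundary GrN S, w ∈ V ∧ w ∉ B ∧ ∃ b ∈ B, (zdGraph 2).Adj b w := by
    rintro w ⟨hwS, v, hv, e, rfl, hadj⟩
    have h1 := ChordalLERW.siteGraph_adj_iff.1 hadj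
    have hwVN : v + SRW.stepVec e ∈ VN := h1.2.2
    refine ⟨hwVN.1, fun hwB => hwS ⟨hwB, hwVN.2⟩, v, hv.1, h1.1⟩
  -- (1) `GN ≤ M · killedHarmExt 1` on `S`
  have hharm : IsKilledHarmonicOn GrN GN S :=
    (SRW.isKilledHarmonicOn_killedGreen hsumN).mono fun u hu huq => hqB (huq ▸ hu.1)
  have h1 : GN x ≤ killedHarmExt GrN S (fun _ => M) x := by
    refine hharm.subharmonicOn.le_killedHarmExt hSfin (fun w hw => ?_) x hxS
    obtain ⟨hwV, hwB, hadjB⟩ := hexit w hw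
    exact (hGNle w).trans (hM w hwV hwB hadjB)
  have h2 : killedHarmExt GrN S (fun _ => M) x = M * killedHarmExt GrN S (fun _ => (1 : ℝ)) x := by
    rw [← killedHarmExt_const_mul hSfin M (fun _ => (1 : ℝ)) x]
    simp only [mul_one]
  -- (2) `killedHarmExt 1 ≤ hit` on `S`: `hit` is super-mean-valued for the windowed walk, `= 1` off `B`
  have hsuper : IsKilledSuperharmonicOn GrN hit S := by
    intro v hv
    have hvc : v ∈ (V \ B)ᶜ := fun h => h.2 hv.1
    have heq := hitBeforeExitProb_isKilledHarmonicOn D (V \ B) v hvc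
    change hit v = killedAvg (ChordalLERW.siteGraph V) hit v at heq
    calc killedAvg GrN hit v ≤ killedAvg (ChordalLERW.siteGraph V) hit v :=
          killedAvg_mono_graph hGrNle (fun w => hitBeforeExitProb_nonneg D w _) v
      _ = hit v := heq.symm
  have h3 : killedHarmExt GrN S (fun _ => (1 : ℝ)) x ≤ hit x := by
    refine hsuper.killedHarmExt_le hSfin (fun w hw => ?_) x hxS
    obtain ⟨hwV, hwB, -⟩ := hexit w hw
    exact (hitBeforeExitProb_eq_one_of_mem D (B := V \ B) ⟨hwV, hwB⟩).ge
  calc GN x ≤ M * killedHarmExt GrN S (fun _ => (1 : ℝ)) x := h2 ▸ h1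
    _ ≤ M * hit x := mul_le_mul_of_nonneg_left h3 hM0

/-- **Lower comparison principle** (the step "since `h` is positive, harmonic, `h(0) = 1` and
`h ≥ M/2` on `J`, this also gives the bound `M ≤ c(ε)`" of the proof of LSW's Prop. 2.2, in the
form in which `J` screens the boundary): let `U ⊆ V(D)` be finite, suppose every lattice
neighbour of every site of `U` lies in `V(D)` (the walk cannot be killed from `U`), that every
lattice neighbour of `U` outside `U` lies in `J ∪ Far` with `U ∩ Far = ∅`, and that
`G(·, q) ≥ m ≥ 0` on `J`. Then for `x ∈ U`, `G(x, q) ≥ m (1 - hitBeforeExitProb D x Far)`: leaving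
`U`, the walk enters `J` (where `G ≥ m`) unless it enters `Far`. [cite: LawlerSchrammWerner2004, §5.2] -/
theorem mul_one_sub_hitBeforeExitProb_le_killedGreen {D : Set ℂ} {q : Site 2}
    (hsum : ∀ y, Summable fun n =>
      SRW.killedTrans (ChordalLERW.siteGraph (latticeVertices D)) n y q)
    {U J Far : Set (Site 2)} (hU : U.Finite) (hUV : U ⊆ latticeVertices D)
    (hUFar : Disjoint U Far)
    (hfull : ∀ u ∈ U, ∀ e : SRW.Dir 2, u + SRW.stepVec e ∈ latticeVertices D)
    (hbd : ∀ u ∈ U, ∀ e : SRW.Dir 2, u + SRW.stepVec e ∉ U →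
      u + SRW.stepVec e ∈ J ∨ u + SRW.stepVec e ∈ Far)
    {m : ℝ} (hm0 : 0 ≤ m)
    (hm : ∀ j ∈ J, m ≤ SRW.killedGreen (ChordalLERW.siteGraph (latticeVertices D)) j q)
    {x : Site 2} (hx : x ∈ U) :
    m * (1 - hitBeforeExitProb D x Far) ≤
      SRW.killedGreen (ChordalLERW.siteGraph (latticeVertices D)) x q := by
  set V := latticeVertices D with hV
  set Gr := ChordalLERW.siteGraph V with hGr
  set G : Site 2 → ℝ := fun u => SRW.killedGreen Gr u q with hG
  set hit : Site 2 → ℝ := fun y => hitBeforeExitProb D y Far with hhit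
  set g : Site 2 → ℝ := fun w => if w ∈ J then 1 else 0 with hg
  -- (1) `m · killedHarmExt g ≤ G` on `U`
  have h1 : killedHarmExt Gr U (fun w => m * g w) x ≤ G x := by
    refine (SRW.isKilledSuperharmonicOn_killedGreen hsum U).killedHarmExt_le hU (fun w _ => ?_) x hx
    change m * g w ≤ G w
    by_cases hwJ : w ∈ J
    · rw [hg]; simp only [hwJ, if_true, mul_one]; exact hm w hwJ
    · rw [hg]; simp only [hwJ, if_false, mul_zero]; exact SRW.killedGreen_nonneg _ _ _
  have h1' : killedHarmExt Gr U (fun w => m * g w) x = m * killedHarmExt Gr U g x :=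
    killedHarmExt_const_mul hU m g x
  -- (2) the constant `1` solves its own Dirichlet problem on `U` (no killing from `U`)
  have hone : IsKilledHarmonicOn Gr (fun _ => (1 : ℝ)) U := by
    intro u hu
    change (1 : ℝ) = killedAvg Gr (fun _ => (1 : ℝ)) u
    rw [killedAvg_def]
    have hall : ∀ e : SRW.Dir 2, Gr.Adj u (u + SRW.stepVec e) := fun e =>
      (siteGraph_adj_add_stepVec_iff u e).2 ⟨hUV hu, hfull u hu e⟩
    simp only [hall, if_true, Finset.sum_const, Finset.card_univ, SRW.card_dir, nsmul_eq_mul, mul_one]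
    norm_num
  have h2 : killedHarmExt Gr U (fun _ => (1 : ℝ)) x = 1 :=
    (hone.eq_killedHarmExt hU (g := fun _ => (1 : ℝ)) (fun _ _ => rfl) x hx).symm
  -- (3) linearity: `killedHarmExt (1 - g) = 1 - killedHarmExt g` at `x`
  have h3 : killedHarmExt Gr U (fun w => 1 - g w) x = 1 - killedHarmExt Gr U g x := by
    have hadd := killedHarmExt_add (Gr := Gr) hU (fun w => 1 - g w) g x
    have hfun : ((fun w => 1 - g w) + g : Site 2 → ℝ) = fun _ => (1 : ℝ) := by
      funext w; simp
    rw [hfun, h2] at hadd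
    linarith
  -- (4) `killedHarmExt (1 - g) ≤ hit` on `U`
  have hUc : U ⊆ Farᶜ := fun u hu huF => Set.disjoint_left.1 hUFar hu huF
  have hsuper : IsKilledSuperharmonicOn Gr hit U :=
    ((hitBeforeExitProb_isKilledHarmonicOn D Far).mono hUc).superharmonicOn
  have h4 : killedHarmExt Gr U (fun w => 1 - g w) x ≤ hit x := by
    refine hsuper.killedHarmExt_le hU (fun w hw => ?_) x hx
    obtain ⟨hwU, u, hu, e, rfl, -⟩ := hw
    by_cases hwJ : u + SRW.stepVec e ∈ J
    · rw [hg]; simp only [hwJ, if_true, sub_self]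
      exact hitBeforeExitProb_nonneg D _ _
    · have hwF : u + SRW.stepVec e ∈ Far := (hbd u hu e hwU).resolve_left hwJ
      rw [hg]; simp only [hwJ, if_false, sub_zero]
      exact (hitBeforeExitProb_eq_one_of_mem D hwF).ge
  -- (5) assemble
  calc m * (1 - hit x) ≤ m * killedHarmExt Gr U g x := by
        refine mul_le_mul_of_nonneg_left ?_ hm0
        linarith
    _ = killedHarmExt Gr U (fun w => m * g w) x := h1'.symm
    _ ≤ G x := h1

end LSWGrid

end Literature.Probability.LatticeModels

end
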